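import Mathlib
import Summits.NavierStokesRegularity.NavierStokesRegularity.Theorems.FilamentSkeletonRssSelectionBoxRJRungNormalBlockSelf
import Summits.NavierStokesRegularity.NavierStokesRegularity.Theorems.FilamentSkeletonRssSelectionBoxRJRungDivFreeTrace

/-!
# Route `FilamentSkeletonRss` · crux `SelectionBoxRJ` (stmt-NavierStokesRegularity-21220) — census for clause 12:
# the determinant condition of the normal block is implied once the core self-rotation dominates

Lane `ns-filament-19175-p1` (g8).  Helper file `--supports stmt-NavierStokesRegularity-21220`; route-independent (bears
equally on `TransverseReductionRJ` stmt-…-21221 and the asides 19174/19175, and on `BoxClausesJ` of the registered line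
`action_gap_seam_J`).  The trace half of clause 12 (`⟪A m, m⟫ + ⟪A n, n⟫ < 0`) is `…RungDivFreeTrace.normalBlock_trace_neg`
(g6); this file does the DETERMINANT half `⟪A n, m⟫⟪A m, n⟫ < ⟪A m, m⟫⟪A n, n⟫`.

THE STEP.  `A = Dv(x₀)` with `v = Σₖ κₖ Fₖ + ½ id − α e₃ × ·`, `Fₖ` the regularised Biot–Savart field (core `1`) of the
filament `Xₖ`, `x₀ = X_j c` a point ON filament `j`, `(t, m, n)` an orthonormal frame with `t = X_j′ c`.  Writing
`a = ⟪A m, m⟫`, `d = ⟪A n, n⟫`, `b = ⟪A n, m⟫`, `c = ⟪A m, n⟫`, one has `4bc = (b + c)² − (b − c)²`, so the determinant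
condition holds as soon as the ROTATIONAL pairing `|b − c|` beats `|b + c| + 2 max(|a|, |d|)`
(`det_of_rotation_dominates`).  By `…RungNormalBlockSelf` the self term contributes `|κ_j|(4/3 − E₂)` to `|b − c|` and at
most `|κ_j| E₁`, `2|κ_j| E₁` to `|a|, |d|`, `|b + c|`; each partner contributes at most `|κₖ| · 8π(D + A_P)/(c_P D³)`
(`…RungPartnerStrain.biotSavart_fderiv_norm_le`, distance `D`, linear escape); the frame part `½ id − α e₃ × ·` contributes
`½` to `a, d`, `0` to `b + c` and at most `2|α|` to `|b − c|`.  Hence (`normalBlock_det_pos`): if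
`6P + 2|α| + 1 < |κ_j| (4/3 − E₂ − 4E₁)` (`P = N · C_κ · 8π(D + A_P)/(c_P D³)`), the determinant condition of clause 12
holds for EVERY orthonormal completion `(m, n)` of the tangent.  In the box (`κ_j = Γγ_j/4π`, `|γ_j| ≥ θ₀`,
`E₁, E₂ = O(K/√Γ) + O(1/Γ)`, `P = O(1)`) this is a largeness condition on `Γ` only (`…RungNormalBlockBox`).

HONEST FRAMING.  Kernel estimates about a HYPOTHETICAL filament box; nothing here is a claim about Navier–Stokes
regularity or blow-up.
-/

set_option linter.dupNamespace false

noncomputable section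

namespace Summit.NavierStokesRegularity.NavierStokesRegularity.Theorems

open Set Function Filter MeasureTheory Real
open Literature.Analysis.FluidPDE
open Summit.NavierStokesRegularity.NavierStokesRegularity.Theorems.SkeletonEquilibrium.Sketch
open scoped InnerProductSpace Topology

namespace SelectionBoxRJRung

/-! ### Linear algebra of the `2 × 2` normal block -/

/-- **Rotation beats strain.** For real `a, b, c, d` with `|a|, |d| ≤ Ā` and `|b + c| + 2Ā < |b − c|`: `b c < a d`
(`4bc = (b + c)² − (b − c)²`). [folklore] -/
theorem det_of_rotation_dominates {a b c d Abar : ℝ} (ha : |a| ≤ Abar) (hd : |d| ≤ Abar)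
    (h : |b + c| + 2 * Abar < |b - c|) : b * c < a * d := by
  have h0 : 0 ≤ Abar := (abs_nonneg a).trans ha
  have had : -(Abar ^ 2) ≤ a * d := by
    have h1 : |a * d| ≤ Abar * Abar := by
      rw [abs_mul]; exact mul_le_mul ha hd (abs_nonneg _) h0
    have h2 := neg_abs_le (a * d)
    nlinarith
  have h1 : (|b + c| + 2 * Abar) ^ 2 < (b - c) ^ 2 := by
    rw [← sq_abs (b - c)]
    exact pow_lt_pow_left₀ h (by positivity) two_ne_zero
  nlinarith [sq_abs (b + c), mul_nonneg h0 (abs_nonneg (b + c))]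

/-- Unpacking an orthonormal frame `(t, m, n)` of `ℝ³`. [folklore] -/
theorem frame_facts {t m n : EuclideanSpace ℝ (Fin 3)} (hon : Orthonormal ℝ ![t, m, n]) :
    ‖t‖ = 1 ∧ ‖m‖ = 1 ∧ ‖n‖ = 1 ∧ ⟪t, m⟫_ℝ = 0 ∧ ⟪t, n⟫_ℝ = 0 ∧ ⟪m, n⟫_ℝ = 0 := by
  rw [orthonormal_vecCons_iff, orthonormal_vecCons_iff, orthonormal_vecCons_iff] at hon
  obtain ⟨ht, htr, hm, hmr, hn, -, -⟩ := hon
  refine ⟨ht, hm, hn, ?_, ?_, ?_⟩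
  · simpa using htr 0
  · simpa using htr 1
  · simpa using hmr 0

/-- Lagrange's identity in `ℝ³`: `‖n × m‖² = ‖n‖² ‖m‖² − ⟪n, m⟫²`. [folklore] -/
theorem norm_cross_sq (n m : EuclideanSpace ℝ (Fin 3)) : ‖cross n m‖ ^ 2 = ‖n‖ ^ 2 * ‖m‖ ^ 2 - ⟪n, m⟫_ℝ ^ 2 := by
  rw [EuclideanSpace.norm_sq_eq, EuclideanSpace.norm_sq_eq, EuclideanSpace.norm_sq_eq]
  simp [cross, crossProduct, PiLp.inner_apply, Fin.sum_univ_three, Real.norm_eq_abs, sq_abs]; ring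

/-- For an orthonormal frame `(t, m, n)` of `ℝ³` the triple product is `±1`: `⟪t, n × m⟫² = 1`. [folklore] -/
theorem inner_cross_sq_eq_one {t m n : EuclideanSpace ℝ (Fin 3)} (hon : Orthonormal ℝ ![t, m, n]) :
    ⟪t, cross n m⟫_ℝ ^ 2 = 1 := by
  obtain ⟨ht, hm, hn, htm, htn, hmn⟩ := frame_facts hon
  have hx : ‖cross n m‖ ^ 2 = 1 := by
    rw [norm_cross_sq, hn, hm, real_inner_comm m n, hmn]; norm_num
  have hsp : Submodule.span ℝ (Set.range ![t, m, n]) = ⊤ :=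
    hon.linearIndependent.span_eq_top_of_card_eq_finrank' (by simp)
  set bs : OrthonormalBasis (Fin 3) ℝ (EuclideanSpace ℝ (Fin 3)) := OrthonormalBasis.mk hon hsp.ge with hbs
  have hb0 : bs 0 = t := by rw [hbs, OrthonormalBasis.coe_mk]; rfl
  have hb1 : bs 1 = m := by rw [hbs, OrthonormalBasis.coe_mk]; rfl
  have hb2 : bs 2 = n := by rw [hbs, OrthonormalBasis.coe_mk]; rfl
  have hpar := bs.sum_inner_mul_inner (cross n m) (cross n m)
  have hxm : ⟪cross n m, m⟫_ℝ = 0 := by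
    simp [cross, crossProduct, PiLp.inner_apply, Fin.sum_univ_three]; ring
  have hxn : ⟪cross n m, n⟫_ℝ = 0 := by
    simp [cross, crossProduct, PiLp.inner_apply, Fin.sum_univ_three]; ring
  rw [Fin.sum_univ_three, hb0, hb1, hb2, hxm, hxn, zero_mul, zero_mul, add_zero, add_zero,
    real_inner_self_eq_norm_sq, hx, real_inner_comm t (cross n m)] at hpar
  rw [pow_two]; exact hpar

/-- The frame part `M y = ½ y − α e₃ × y` of `Dv`: for an orthonormal pair `(m, n)`,
`⟪M m, m⟫ = ⟪M n, n⟫ = ½`, `⟪M n, m⟫ + ⟪M m, n⟫ = 0`, `|⟪M n, m⟫ − ⟪M m, n⟫| ≤ 2|α|`. [folklore] -/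
theorem framePart_entries (α : ℝ) {m n : EuclideanSpace ℝ (Fin 3)} (hm : ‖m‖ = 1) (hn : ‖n‖ = 1)
    (hmn : ⟪m, n⟫_ℝ = 0) :
    ⟪(1 / 2 : ℝ) • m - α • cross (EuclideanSpace.single 2 1) m, m⟫_ℝ = 1 / 2 ∧
    ⟪(1 / 2 : ℝ) • n - α • cross (EuclideanSpace.single 2 1) n, n⟫_ℝ = 1 / 2 ∧
    ⟪(1 / 2 : ℝ) • n - α • cross (EuclideanSpace.single 2 1) n, m⟫_ℝ +
      ⟪(1 / 2 : ℝ) • m - α • cross (EuclideanSpace.single 2 1) m, n⟫_ℝ = 0 ∧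
    |⟪(1 / 2 : ℝ) • n - α • cross (EuclideanSpace.single 2 1) n, m⟫_ℝ -
      ⟪(1 / 2 : ℝ) • m - α • cross (EuclideanSpace.single 2 1) m, n⟫_ℝ| ≤ 2 * |α| := by
  have hperp : ∀ a b : EuclideanSpace ℝ (Fin 3), ⟪cross a b, b⟫_ℝ = 0 := fun a b => by
    simp [cross, crossProduct, PiLp.inner_apply, Fin.sum_univ_three]; ring
  have hanti : ∀ a b d : EuclideanSpace ℝ (Fin 3), ⟪cross a b, d⟫_ℝ = -⟪cross a d, b⟫_ℝ := fun a b d => by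
    simp [cross, crossProduct, PiLp.inner_apply, Fin.sum_univ_three]; ring
  have hmm : ⟪m, m⟫_ℝ = 1 := by rw [real_inner_self_eq_norm_sq, hm, one_pow]
  have hnn : ⟪n, n⟫_ℝ = 1 := by rw [real_inner_self_eq_norm_sq, hn, one_pow]
  have hnm : ⟪n, m⟫_ℝ = 0 := by rw [real_inner_comm, hmn]
  have he3 : ‖(EuclideanSpace.single (2 : Fin 3) (1 : ℝ) : EuclideanSpace ℝ (Fin 3))‖ = 1 := by
    rw [PiLp.norm_single, norm_one]
  have hbd : |⟪cross (EuclideanSpace.single 2 1) n, m⟫_ℝ| ≤ 1 := by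
    calc |⟪cross (EuclideanSpace.single 2 1) n, m⟫_ℝ| ≤ ‖cross (EuclideanSpace.single (2 : Fin 3) (1 : ℝ)) n‖ * ‖m‖ :=
          abs_real_inner_le_norm _ _
      _ ≤ (‖(EuclideanSpace.single (2 : Fin 3) (1 : ℝ) : EuclideanSpace ℝ (Fin 3))‖ * ‖n‖) * ‖m‖ :=
          mul_le_mul_of_nonneg_right (norm_cross_le_norm_mul_norm _ _) (norm_nonneg _)
      _ = 1 := by rw [he3, hn, hm]; ring
  refine ⟨?_, ?_, ?_, ?_⟩
  · rw [inner_sub_left, real_inner_smul_left, real_inner_smul_left, hmm, hperp]; ring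
  · rw [inner_sub_left, real_inner_smul_left, real_inner_smul_left, hnn, hperp]; ring
  · rw [inner_sub_left, real_inner_smul_left, real_inner_smul_left, inner_sub_left, real_inner_smul_left,
      real_inner_smul_left, hnm, hmn, hanti _ m n]; ring
  · rw [inner_sub_left, real_inner_smul_left, real_inner_smul_left, inner_sub_left, real_inner_smul_left,
      real_inner_smul_left, hnm, hmn, hanti _ m n]
    have : |(1 / 2 : ℝ) * 0 - α * ⟪cross (EuclideanSpace.single 2 1) n, m⟫_ℝ -
        ((1 / 2 : ℝ) * 0 - α * -⟪cross (EuclideanSpace.single 2 1) n, m⟫_ℝ)| =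
        2 * |α| * |⟪cross (EuclideanSpace.single 2 1) n, m⟫_ℝ| := by
      rw [show (1 / 2 : ℝ) * 0 - α * ⟪cross (EuclideanSpace.single 2 1) n, m⟫_ℝ -
        ((1 / 2 : ℝ) * 0 - α * -⟪cross (EuclideanSpace.single 2 1) n, m⟫_ℝ) =
        -(2 * (α * ⟪cross (EuclideanSpace.single 2 1) n, m⟫_ℝ)) by ring, abs_neg, abs_mul, abs_mul]
      norm_num; ring
    rw [this]
    nlinarith [abs_nonneg α]

/-! ### The determinant half of clause 12 -/

/-- **Determinant condition of clause 12 from rotation dominance.**  Let `v = Σₖ κₖ Fₖ + ½ id − α e₃ × ·` be the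
frame velocity of `N` filaments `Xₖ` (each `C¹`, `‖Xₖ′‖ ≤ 1`, linear growth — the Biot–Savart stubs' hypotheses, core
`1`), `x₀ = X_j c` a point on filament `j`, which is `C²`, unit-speed, with curvature `≤ κ₀` and the two-region geometry
of `…RungNormalBlockSelf` (`κ₀ S₁ ≤ 1/2`; distance `≥ D₁` beyond `S₁`; escape `c₁|u − c| − A₁`), the other filaments at
distance `≥ D` from `x₀` with escape `c_P|u − u₀ₖ| − A_P` and coefficients `|κₖ| ≤ C_κ`.  If
`6 N C_κ P₀ + 2|α| + 1 < |κ_j| (4/3 − E₂ − 4E₁)` (`P₀ = 8π(D + A_P)/(c_P D³)`, `E₁, E₂` as in `…RungNormalBlockSelf`),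
then for EVERY orthonormal completion `(m, n)` of the tangent `X_j′ c`, with `A = Dv(x₀)`:
`⟪A n, m⟫ ⟪A m, n⟫ < ⟪A m, m⟫ ⟪A n, n⟫`. [folklore] -/
theorem normalBlock_det_pos {N : ℕ} {X : Fin N → ℝ → EuclideanSpace ℝ (Fin 3)} {coef : Fin N → ℝ} {α : ℝ}
    {j : Fin N} {c : ℝ} {c₀ : ℝ} {C : Fin N → ℝ} (hc₀ : 0 < c₀) (hX1 : ∀ k, ContDiff ℝ 1 (X k))
    (hdX : ∀ k u, ‖deriv (X k) u‖ ≤ 1) (hgrow : ∀ k u, c₀ * |u| - C k ≤ ‖X k u‖)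
    {κ₀ S₁ D₁ c₁ A₁ : ℝ} (hXj : ContDiff ℝ 2 (X j)) (hunit : ∀ u, ‖deriv (X j) u‖ = 1)
    (hκ : ∀ u, ‖deriv (deriv (X j)) u‖ ≤ κ₀) (hS₁ : κ₀ * S₁ ≤ 1 / 2) (hc₁ : 0 < c₁) (hD₁ : 0 < D₁)
    (hA₁ : 0 ≤ A₁) (hfar : ∀ u, S₁ ≤ |u - c| → D₁ ≤ ‖X j c - X j u‖)
    (hesc : ∀ u, c₁ * |u - c| - A₁ ≤ ‖X j c - X j u‖)
    {D cP AP : ℝ} {u₀ : Fin N → ℝ} (hD : 0 < D) (hcP : 0 < cP) (hAP : 0 ≤ AP)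
    (hpfar : ∀ k, k ≠ j → ∀ u, D ≤ ‖X j c - X k u‖)
    (hpesc : ∀ k, k ≠ j → ∀ u, cP * |u - u₀ k| - AP ≤ ‖X j c - X k u‖)
    {Cκ : ℝ} (hCκ0 : 0 ≤ Cκ) (hCκ : ∀ k, k ≠ j → |coef k| ≤ Cκ)
    {m n : EuclideanSpace ℝ (Fin 3)} (hon : Orthonormal ℝ ![deriv (X j) c, m, n])
    (hbig : 6 * (N * (Cκ * (8 * Real.pi * (D + AP) / (cP * D ^ 3)))) + 2 * |α| + 1 <
      |coef j| * (4 / 3 - (416 * Real.pi * κ₀ + 20 * Real.pi * (D₁ + A₁) / (c₁ * D₁ ^ 3)) -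
        4 * (192 * Real.pi * κ₀ + 8 * Real.pi * (D₁ + A₁) / (c₁ * D₁ ^ 3)))) :
    ⟪fderiv ℝ (fun y : EuclideanSpace ℝ (Fin 3) =>
          (∑ k, coef k • ∫ u : ℝ, ((‖y - X k u‖ ^ 2 + 1) ^ (3 / 2 : ℝ))⁻¹ • cross (deriv (X k) u) (y - X k u))
            + (1 / 2 : ℝ) • y - α • cross (EuclideanSpace.single 2 1) y) (X j c) n, m⟫_ℝ *
      ⟪fderiv ℝ (fun y : EuclideanSpace ℝ (Fin 3) =>
          (∑ k, coef k • ∫ u : ℝ, ((‖y - X k u‖ ^ 2 + 1) ^ (3 / 2 : ℝ))⁻¹ • cross (deriv (X k) u) (y - X k u))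
            + (1 / 2 : ℝ) • y - α • cross (EuclideanSpace.single 2 1) y) (X j c) m, n⟫_ℝ <
    ⟪fderiv ℝ (fun y : EuclideanSpace ℝ (Fin 3) =>
          (∑ k, coef k • ∫ u : ℝ, ((‖y - X k u‖ ^ 2 + 1) ^ (3 / 2 : ℝ))⁻¹ • cross (deriv (X k) u) (y - X k u))
            + (1 / 2 : ℝ) • y - α • cross (EuclideanSpace.single 2 1) y) (X j c) m, m⟫_ℝ *
      ⟪fderiv ℝ (fun y : EuclideanSpace ℝ (Fin 3) =>
          (∑ k, coef k • ∫ u : ℝ, ((‖y - X k u‖ ^ 2 + 1) ^ (3 / 2 : ℝ))⁻¹ • cross (deriv (X k) u) (y - X k u))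
            + (1 / 2 : ℝ) • y - α • cross (EuclideanSpace.single 2 1) y) (X j c) n, n⟫_ℝ := by
  obtain ⟨ht, hm, hn, htm, htn, hmn⟩ := frame_facts hon
  -- the fields and their derivatives at `x₀ = X j c`
  obtain ⟨F, hF⟩ : ∃ F : Fin N → EuclideanSpace ℝ (Fin 3) → EuclideanSpace ℝ (Fin 3), F = fun k y =>
      ∫ u : ℝ, ((‖y - X k u‖ ^ 2 + 1) ^ (3 / 2 : ℝ))⁻¹ • cross (deriv (X k) u) (y - X k u) := ⟨_, rfl⟩
  have hdiff : ∀ k, Differentiable ℝ (F k) := fun k => by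
    have h := stub_biotSavartDifferentiable 1 c₀ (C k) (X k) one_ne_zero hc₀ (hX1 k) (hdX k) (hgrow k)
    rw [hF]; simpa only [one_pow] using h
  obtain ⟨L, hL⟩ : ∃ L : Fin N → (EuclideanSpace ℝ (Fin 3) →L[ℝ] EuclideanSpace ℝ (Fin 3)),
      L = fun k => fderiv ℝ (F k) (X j c) := ⟨_, rfl⟩
  set Lrot : EuclideanSpace ℝ (Fin 3) →L[ℝ] EuclideanSpace ℝ (Fin 3) :=
    crossCLM (EuclideanSpace.single (2 : Fin 3) (1 : ℝ)) with hLrot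
  set M : EuclideanSpace ℝ (Fin 3) →L[ℝ] EuclideanSpace ℝ (Fin 3) :=
    (1 / 2 : ℝ) • ContinuousLinearMap.id ℝ _ - α • Lrot with hM
  have hMapp : ∀ y, M y = (1 / 2 : ℝ) • y - α • cross (EuclideanSpace.single 2 1) y := fun y => by
    simp [hM, hLrot]
  have hsum : HasFDerivAt (fun y : EuclideanSpace ℝ (Fin 3) => ∑ k, coef k • F k y)
      (∑ k, coef k • L k) (X j c) := by
    rw [hL]; exact HasFDerivAt.fun_sum fun k _ => (((hdiff k) (X j c)).hasFDerivAt).const_smul (coef k)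
  have hlin : HasFDerivAt (fun y : EuclideanSpace ℝ (Fin 3) =>
      (1 / 2 : ℝ) • y - α • cross (EuclideanSpace.single 2 1) y) M (X j c) := by
    have hf : (fun y : EuclideanSpace ℝ (Fin 3) => (1 / 2 : ℝ) • y - α • cross (EuclideanSpace.single 2 1) y) =
        fun y => M y := funext fun y => (hMapp y).symm
    rw [hf]; exact M.hasFDerivAt
  have hfd : fderiv ℝ (fun y : EuclideanSpace ℝ (Fin 3) =>
        (∑ k, coef k • F k y) + ((1 / 2 : ℝ) • y - α • cross (EuclideanSpace.single 2 1) y)) (X j c) =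
      (∑ k, coef k • L k) + M := (hsum.add hlin).fderiv
  have hfun : (fun y : EuclideanSpace ℝ (Fin 3) =>
        (∑ k, coef k • ∫ u : ℝ, ((‖y - X k u‖ ^ 2 + 1) ^ (3 / 2 : ℝ))⁻¹ • cross (deriv (X k) u) (y - X k u))
          + (1 / 2 : ℝ) • y - α • cross (EuclideanSpace.single 2 1) y) =
      fun y => (∑ k, coef k • F k y) + ((1 / 2 : ℝ) • y - α • cross (EuclideanSpace.single 2 1) y) := by
    funext y; simp only [hF]; abel
  rw [hfun, hfd]
  -- entries of the block
  have hentry : ∀ h l : EuclideanSpace ℝ (Fin 3), ⟪((∑ k, coef k • L k) + M) h, l⟫_ℝ =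
      coef j * ⟪L j h, l⟫_ℝ + (∑ k ∈ Finset.univ.erase j, coef k * ⟪L k h, l⟫_ℝ) +
        ⟪(1 / 2 : ℝ) • h - α • cross (EuclideanSpace.single 2 1) h, l⟫_ℝ := by
    intro h l
    have happly : ((∑ k, coef k • L k) + M) h = (∑ k, coef k • L k h) + M h := by simp
    rw [happly, hMapp, inner_add_left, sum_inner]
    have hterm : ∀ k, ⟪coef k • L k h, l⟫_ℝ = coef k * ⟪L k h, l⟫_ℝ := fun k => real_inner_smul_left _ _ _
    simp_rw [hterm]
    rw [← Finset.add_sum_erase _ _ (Finset.mem_univ j)]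
  -- partner bound
  obtain ⟨P₀, hP₀⟩ : ∃ P₀ : ℝ, P₀ = 8 * Real.pi * (D + AP) / (cP * D ^ 3) := ⟨_, rfl⟩
  have hP₀nn : 0 ≤ P₀ := by rw [hP₀]; positivity
  have hLk : ∀ k, k ≠ j → ‖L k‖ ≤ P₀ := fun k hk => by
    have h := biotSavart_fderiv_norm_le (y := X j c) one_ne_zero hc₀ (hX1 k) (hdX k) (hgrow k) hcP hD hAP
      (hpfar k hk) (hpesc k hk)
    rw [hL, hP₀, hF]; simpa only [one_pow] using h
  have hterm_le : ∀ k, k ≠ j → ∀ h l : EuclideanSpace ℝ (Fin 3), ‖h‖ = 1 → ‖l‖ = 1 →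
      |coef k * ⟪L k h, l⟫_ℝ| ≤ Cκ * P₀ := by
    intro k hk h l hh hl
    rw [abs_mul]
    have h1 : |⟪L k h, l⟫_ℝ| ≤ P₀ := by
      calc |⟪L k h, l⟫_ℝ| ≤ ‖L k h‖ * ‖l‖ := abs_real_inner_le_norm _ _
        _ ≤ (‖L k‖ * ‖h‖) * ‖l‖ := mul_le_mul_of_nonneg_right ((L k).le_opNorm h) (norm_nonneg _)
        _ = ‖L k‖ := by rw [hh, hl, mul_one, mul_one]
        _ ≤ P₀ := hLk k hk
    exact mul_le_mul (hCκ k hk) h1 (abs_nonneg _) ((abs_nonneg _).trans (hCκ k hk))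
  obtain ⟨Pv, hPv⟩ : ∃ Pv : ℝ, Pv = N * (Cκ * P₀) := ⟨_, rfl⟩
  have hS : ∀ h l : EuclideanSpace ℝ (Fin 3), ‖h‖ = 1 → ‖l‖ = 1 →
      |∑ k ∈ Finset.univ.erase j, coef k * ⟪L k h, l⟫_ℝ| ≤ Pv := by
    intro h l hh hl
    have h1 : |∑ k ∈ Finset.univ.erase j, coef k * ⟪L k h, l⟫_ℝ| ≤
        ∑ k ∈ Finset.univ.erase j, |coef k * ⟪L k h, l⟫_ℝ| := Finset.abs_sum_le_sum_abs _ _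
    have h2 : ∑ k ∈ Finset.univ.erase j, |coef k * ⟪L k h, l⟫_ℝ| ≤ (Finset.univ.erase j).card • (Cκ * P₀) :=
      Finset.sum_le_card_nsmul _ _ _ fun k hk => hterm_le k (Finset.ne_of_mem_erase hk) h l hh hl
    rw [nsmul_eq_mul] at h2
    have hCP : 0 ≤ Cκ * P₀ := mul_nonneg hCκ0 hP₀nn
    have h3 : ((Finset.univ.erase j).card : ℝ) * (Cκ * P₀) ≤ N * (Cκ * P₀) := by
      have hc : ((Finset.univ.erase j).card : ℝ) ≤ N := by
        have := Finset.card_erase_le (s := Finset.univ) (a := j)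
        rw [Finset.card_univ, Fintype.card_fin] at this
        exact_mod_cast this
      exact mul_le_mul_of_nonneg_right hc hCP
    rw [hPv]; linarith
  have hPvnn : 0 ≤ Pv := by rw [hPv]; exact mul_nonneg (Nat.cast_nonneg N) (mul_nonneg hCκ0 hP₀nn)
  -- self bounds
  obtain ⟨E₁, hE₁⟩ : ∃ E₁ : ℝ, E₁ = 192 * Real.pi * κ₀ + 8 * Real.pi * (D₁ + A₁) / (c₁ * D₁ ^ 3) := ⟨_, rfl⟩
  obtain ⟨E₂, hE₂⟩ : ∃ E₂ : ℝ, E₂ = 416 * Real.pi * κ₀ + 20 * Real.pi * (D₁ + A₁) / (c₁ * D₁ ^ 3) := ⟨_, rfl⟩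
  have hmt : ⟪m, deriv (X j) c⟫_ℝ = 0 := by rw [real_inner_comm, htm]
  have hnt : ⟪n, deriv (X j) c⟫_ℝ = 0 := by rw [real_inner_comm, htn]
  have hLj : L j = fderiv ℝ (fun y : EuclideanSpace ℝ (Fin 3) => ∫ u : ℝ,
      ((‖y - X j u‖ ^ 2 + 1) ^ (3 / 2 : ℝ))⁻¹ • cross (deriv (X j) u) (y - X j u)) (X j c) := by rw [hL, hF]
  have hsymm := fun (h l : EuclideanSpace ℝ (Fin 3)) (hh : ‖h‖ = 1) (hl : ‖l‖ = 1)
      (hht : ⟪h, deriv (X j) c⟫_ℝ = 0) (hlt : ⟪l, deriv (X j) c⟫_ℝ = 0) =>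
    self_normalBlock_symm_le hXj hunit hκ hc₀ (hgrow j) hS₁ hc₁ hD₁ hA₁ hfar hesc hh hl hht hlt
  have hamm : |⟪L j m, m⟫_ℝ| ≤ E₁ := by
    have h := hsymm m m hm hm hmt hmt
    rw [← hLj, ← hE₁] at h
    have : ⟪L j m, m⟫_ℝ + ⟪L j m, m⟫_ℝ = 2 * ⟪L j m, m⟫_ℝ := by ring
    rw [this, abs_mul, abs_two] at h
    linarith
  have hann : |⟪L j n, n⟫_ℝ| ≤ E₁ := by
    have h := hsymm n n hn hn hnt hnt
    rw [← hLj, ← hE₁] at h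
    have : ⟪L j n, n⟫_ℝ + ⟪L j n, n⟫_ℝ = 2 * ⟪L j n, n⟫_ℝ := by ring
    rw [this, abs_mul, abs_two] at h
    linarith
  have hsnm : |⟪L j n, m⟫_ℝ + ⟪L j m, n⟫_ℝ| ≤ 2 * E₁ := by
    have h := hsymm n m hn hm hnt hmt
    rw [← hLj, ← hE₁] at h
    exact h
  have hrnm : 4 / 3 - E₂ ≤ |⟪L j n, m⟫_ℝ - ⟪L j m, n⟫_ℝ| := by
    have h := self_normalBlock_anti_ge hXj hunit hκ hc₀ (hgrow j) hS₁ hc₁ hD₁ hA₁ hfar hesc hm hn hmt hnt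
    rw [← hLj, ← hE₂, inner_cross_sq_eq_one hon, mul_one] at h
    have hσ : |⟪deriv (X j) c, cross n m⟫_ℝ| = 1 := by
      have h1 := inner_cross_sq_eq_one hon
      rw [← sq_abs] at h1
      exact (pow_eq_one_iff_of_nonneg (abs_nonneg _) two_ne_zero).1 h1
    have h2 := le_abs_self (⟪deriv (X j) c, cross n m⟫_ℝ * (⟪L j n, m⟫_ℝ - ⟪L j m, n⟫_ℝ))
    rw [abs_mul, hσ, one_mul] at h2
    linarith
  -- frame part
  obtain ⟨hMmm, hMnn, hMsum, hMdiff⟩ := framePart_entries α hm hn hmn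
  -- the four entries
  rw [hentry n m, hentry m n, hentry m m, hentry n n]
  have hSmm := hS m m hm hm
  have hSnn := hS n n hn hn
  have hSnm := hS n m hn hm
  have hSmn := hS m n hm hn
  obtain ⟨Q, hQ⟩ : ∃ Q : ℝ, Q = |coef j| := ⟨_, rfl⟩
  have hQnn : 0 ≤ Q := by rw [hQ]; exact abs_nonneg _
  have hbig' : 6 * Pv + 2 * |α| + 1 < Q * (4 / 3 - E₂ - 4 * E₁) := by rw [hPv, hQ, hE₁, hE₂, hP₀]; exact hbig
  refine det_of_rotation_dominates (Abar := Q * E₁ + Pv + 1 / 2) ?_ ?_ ?_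
  · -- `|a| ≤ Ā`
    rw [hMmm]
    have h1 : |coef j * ⟪L j m, m⟫_ℝ| ≤ Q * E₁ := by rw [abs_mul, hQ]; exact mul_le_mul_of_nonneg_left hamm (abs_nonneg _)
    calc _ ≤ |coef j * ⟪L j m, m⟫_ℝ + ∑ k ∈ Finset.univ.erase j, coef k * ⟪L k m, m⟫_ℝ| + |(1 / 2 : ℝ)| :=
          abs_add_le _ _
      _ ≤ (|coef j * ⟪L j m, m⟫_ℝ| + |∑ k ∈ Finset.univ.erase j, coef k * ⟪L k m, m⟫_ℝ|) + 1 / 2 := by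
          rw [abs_of_pos (by norm_num : (0:ℝ) < 1 / 2)]; exact add_le_add (abs_add_le _ _) le_rfl
      _ ≤ (Q * E₁ + Pv) + 1 / 2 := by linarith
      _ = _ := by ring
  · -- `|d| ≤ Ā`
    rw [hMnn]
    have h1 : |coef j * ⟪L j n, n⟫_ℝ| ≤ Q * E₁ := by rw [abs_mul, hQ]; exact mul_le_mul_of_nonneg_left hann (abs_nonneg _)
    calc _ ≤ |coef j * ⟪L j n, n⟫_ℝ + ∑ k ∈ Finset.univ.erase j, coef k * ⟪L k n, n⟫_ℝ| + |(1 / 2 : ℝ)| :=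
          abs_add_le _ _
      _ ≤ (|coef j * ⟪L j n, n⟫_ℝ| + |∑ k ∈ Finset.univ.erase j, coef k * ⟪L k n, n⟫_ℝ|) + 1 / 2 := by
          rw [abs_of_pos (by norm_num : (0:ℝ) < 1 / 2)]; exact add_le_add (abs_add_le _ _) le_rfl
      _ ≤ (Q * E₁ + Pv) + 1 / 2 := by linarith
      _ = _ := by ring
  · -- `|b + c| + 2Ā < |b − c|`
    have hplus : |coef j * ⟪L j n, m⟫_ℝ + (∑ k ∈ Finset.univ.erase j, coef k * ⟪L k n, m⟫_ℝ) +
          ⟪(1 / 2 : ℝ) • n - α • cross (EuclideanSpace.single 2 1) n, m⟫_ℝ +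
        (coef j * ⟪L j m, n⟫_ℝ + (∑ k ∈ Finset.univ.erase j, coef k * ⟪L k m, n⟫_ℝ) +
          ⟪(1 / 2 : ℝ) • m - α • cross (EuclideanSpace.single 2 1) m, n⟫_ℝ)| ≤ 2 * Q * E₁ + 2 * Pv := by
      have hre : coef j * ⟪L j n, m⟫_ℝ + (∑ k ∈ Finset.univ.erase j, coef k * ⟪L k n, m⟫_ℝ) +
            ⟪(1 / 2 : ℝ) • n - α • cross (EuclideanSpace.single 2 1) n, m⟫_ℝ +
          (coef j * ⟪L j m, n⟫_ℝ + (∑ k ∈ Finset.univ.erase j, coef k * ⟪L k m, n⟫_ℝ) +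
            ⟪(1 / 2 : ℝ) • m - α • cross (EuclideanSpace.single 2 1) m, n⟫_ℝ) =
          coef j * (⟪L j n, m⟫_ℝ + ⟪L j m, n⟫_ℝ) +
            ((∑ k ∈ Finset.univ.erase j, coef k * ⟪L k n, m⟫_ℝ) + ∑ k ∈ Finset.univ.erase j, coef k * ⟪L k m, n⟫_ℝ) +
            (⟪(1 / 2 : ℝ) • n - α • cross (EuclideanSpace.single 2 1) n, m⟫_ℝ +
              ⟪(1 / 2 : ℝ) • m - α • cross (EuclideanSpace.single 2 1) m, n⟫_ℝ) := by ring
      rw [hre, hMsum, add_zero]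
      have h1 : |coef j * (⟪L j n, m⟫_ℝ + ⟪L j m, n⟫_ℝ)| ≤ Q * (2 * E₁) := by
        rw [abs_mul, hQ]; exact mul_le_mul_of_nonneg_left hsnm (abs_nonneg _)
      calc _ ≤ |coef j * (⟪L j n, m⟫_ℝ + ⟪L j m, n⟫_ℝ)| +
            |(∑ k ∈ Finset.univ.erase j, coef k * ⟪L k n, m⟫_ℝ) + ∑ k ∈ Finset.univ.erase j, coef k * ⟪L k m, n⟫_ℝ| :=
            abs_add_le _ _
        _ ≤ Q * (2 * E₁) + (Pv + Pv) := add_le_add h1 ((abs_add_le _ _).trans (add_le_add hSnm hSmn))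
        _ = _ := by ring
    have hminus : Q * (4 / 3 - E₂) - 2 * Pv - 2 * |α| ≤
        |coef j * ⟪L j n, m⟫_ℝ + (∑ k ∈ Finset.univ.erase j, coef k * ⟪L k n, m⟫_ℝ) +
          ⟪(1 / 2 : ℝ) • n - α • cross (EuclideanSpace.single 2 1) n, m⟫_ℝ -
        (coef j * ⟪L j m, n⟫_ℝ + (∑ k ∈ Finset.univ.erase j, coef k * ⟪L k m, n⟫_ℝ) +
          ⟪(1 / 2 : ℝ) • m - α • cross (EuclideanSpace.single 2 1) m, n⟫_ℝ)| := by
      have hre : coef j * ⟪L j n, m⟫_ℝ + (∑ k ∈ Finset.univ.erase j, coef k * ⟪L k n, m⟫_ℝ) +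
            ⟪(1 / 2 : ℝ) • n - α • cross (EuclideanSpace.single 2 1) n, m⟫_ℝ -
          (coef j * ⟪L j m, n⟫_ℝ + (∑ k ∈ Finset.univ.erase j, coef k * ⟪L k m, n⟫_ℝ) +
            ⟪(1 / 2 : ℝ) • m - α • cross (EuclideanSpace.single 2 1) m, n⟫_ℝ) =
          coef j * (⟪L j n, m⟫_ℝ - ⟪L j m, n⟫_ℝ) +
            (((∑ k ∈ Finset.univ.erase j, coef k * ⟪L k n, m⟫_ℝ) - ∑ k ∈ Finset.univ.erase j, coef k * ⟪L k m, n⟫_ℝ) +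
            (⟪(1 / 2 : ℝ) • n - α • cross (EuclideanSpace.single 2 1) n, m⟫_ℝ -
              ⟪(1 / 2 : ℝ) • m - α • cross (EuclideanSpace.single 2 1) m, n⟫_ℝ)) := by ring
      rw [hre]
      have h1 : Q * (4 / 3 - E₂) ≤ |coef j * (⟪L j n, m⟫_ℝ - ⟪L j m, n⟫_ℝ)| := by
        rw [abs_mul, hQ]; exact mul_le_mul_of_nonneg_left hrnm (abs_nonneg _)
      have h2 : |((∑ k ∈ Finset.univ.erase j, coef k * ⟪L k n, m⟫_ℝ) -
              ∑ k ∈ Finset.univ.erase j, coef k * ⟪L k m, n⟫_ℝ) +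
            (⟪(1 / 2 : ℝ) • n - α • cross (EuclideanSpace.single 2 1) n, m⟫_ℝ -
              ⟪(1 / 2 : ℝ) • m - α • cross (EuclideanSpace.single 2 1) m, n⟫_ℝ)| ≤ (Pv + Pv) + 2 * |α| :=
        (abs_add_le _ _).trans (add_le_add ((abs_sub _ _).trans (add_le_add hSnm hSmn)) hMdiff)
      have h3 := abs_sub_abs_le_abs_add (coef j * (⟪L j n, m⟫_ℝ - ⟪L j m, n⟫_ℝ))
        (((∑ k ∈ Finset.univ.erase j, coef k * ⟪L k n, m⟫_ℝ) - ∑ k ∈ Finset.univ.erase j, coef k * ⟪L k m, n⟫_ℝ) +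
          (⟪(1 / 2 : ℝ) • n - α • cross (EuclideanSpace.single 2 1) n, m⟫_ℝ -
            ⟪(1 / 2 : ℝ) • m - α • cross (EuclideanSpace.single 2 1) m, n⟫_ℝ))
      linarith
    have hE₁nn : 0 ≤ Q * E₁ := mul_nonneg hQnn ((abs_nonneg _).trans hamm)
    linarith

end SelectionBoxRJRung

end Summit.NavierStokesRegularity.NavierStokesRegularity.Theorems
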